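import Literature.AlgebraicGeometry.HodgeTheory.DworkSexticReflectionQuotient
import Literature.AlgebraicGeometry.HodgeTheory.ComplexPointsLocallyContractible
import Literature.AlgebraicGeometry.Motives.FiniteQuotientDescentOfTransfer
import Literature.AlgebraicGeometry.Motives.ComplexPointsManifold
import Literature.AlgebraicTopology.SingularHomology.SemiFreeQuotientTransfer
import Literature.Geometry.Manifold.TopologicalEmbedding
import HarnessLib

/-!
# The transfer `H⁴(X_ψ/⟨s⟩) ≅ H⁴(X_ψ)^s` for the reflection quotients of the Dwork sextic, PROVED;
# reflection-invariant rational `(2,2)`-classes are algebraic, granted only Bini–Garbagnati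

Family `hodge`, layer `Literature/AlgebraicGeometry/HodgeTheory` (namespace `DworkSextic`). Route
`DworkReflectionQuotients` (cell `hodge-nonav`), crux `ReflectionQuotientDescent`
(stmt-HodgeConjecture-20240). The tree's `DworkSextic.mem_algebraicClasses_of_isRefl_invariant`
(`DworkSexticReflectionQuotient.lean`) rests on THREE inputs: Bredon's transfer
`bredon1997_quotient_cohomology_invariants` (a named fact), Bini–Garbagnati Prop. 3.20
`BiniGarbagnati2012_reflectionQuotient_smoothProjective_rcc` (a named fact), and Fulton's pull-back
(`fulton1998_map_mem_algebraicClasses`, a tree theorem). This file REMOVES the first: for the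
quotient map `p : X_ψ → X_ψ/⟨s_(i,j,ζ)⟩` (`ψ⁶ ≠ 1`) the transfer —
`p^* : Hᵏ((X_ψ/⟨s⟩)(ℂ); ℂ) → Hᵏ(X_ψ(ℂ); ℂ)` is injective with range the `⟨s⟩`-invariant classes —
is PROVED (`reflTransfer`), granted only Bini–Garbagnati (used for: the quotient is smooth
projective, so that its complex points form a compact manifold, an ENR), by the tree's theorem for
semi-free actions with taut fixed locus
(`AlgebraicTopology/SingularHomology/SemiFreeQuotientTransfer.lean`, Bredon II.19.2 proved in that
case): an involution is semi-free; its fixed locus on `X_ψ(ℂ)` is the hyperplane section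
`{x_i = ζ x_j}` (`setOf_pointsAction_eq_self_eq`; the isolated fixed point `[e_i - ζ⁻¹… ]` of the
reflection of `ℙ⁵` is not on `X_ψ`), the complex points of a Zariski-closed subset, hence locally
contractible (`locallyContractibleSpace_complexPoints`, semialgebraic triangulation) and taut in the
ENR `X_ψ(ℂ)` (`Cech.RetractionNhds.nonempty_of_locallyContractibleSpace`); its homeomorphic image
is taut in the ENR `(X_ψ/⟨s⟩)(ℂ)`.

* `nonempty_retractionNhds_of_isSmoothProjective` — compact locally contractible subsets of
  `X(ℂ)`, `X` smooth projective, are taut (the ENR road of `HodgeSectionRestrictionProofs`);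
* `DworkSextic.pointsAction_eq_self_iff`, `DworkSextic.setOf_pointsAction_eq_self_eq`,
  `DworkSextic.locallyContractibleSpace_fix` — the fixed locus of `s_(i,j,ζ)` on `X_ψ(ℂ)`;
* `DworkSextic.reflTransfer` — **the transfer for `X_ψ → X_ψ/⟨s⟩`**, granted Bini–Garbagnati;
* `DworkSextic.exists_rational_hodge_map_reflQuotientMap_eq_of_BG`,
  **`DworkSextic.mem_algebraicClasses_of_isRefl_invariant_of_BG`** — the consumers of
  `DworkSexticReflectionQuotient` §5 with the Bredon hypothesis discharged.

Everything here is proved; no named facts are introduced.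

## References

* [Bredon1997] G. E. Bredon, *Sheaf Theory*, 2nd ed., GTM 170 (1997), II Thm. 19.2.
* [BiniGarbagnati2012] G. Bini, A. Garbagnati, *Quotients of the Dwork pencil*, J. Geom. Phys. 75
  (2014), §3.4 and Prop. 3.20.
* [Spanier1981] E. H. Spanier, *Algebraic Topology*, Ch. 6 §1, Thm. 10 and Cor. 11.
* [Fulton1998] W. Fulton, *Intersection Theory* (1998), §19.2 Cor. 19.2 (b).
* [BlochSrinivas1983] S. Bloch, V. Srinivas, Amer. J. Math. 105 (1983), Thm. 1 (3).
-/

noncomputable section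

open CategoryTheory AlgebraicGeometry MvPolynomial Set
open scoped LinearAlgebra.Projectivization
open Literature.AlgebraicGeometry.Motives Literature.AlgebraicGeometry.RelativeSpec
open Literature.AlgebraicTopology.SingularHomology Literature.AlgebraicTopology.Homotopy
open Literature.NumberTheory.Transcendental

namespace Literature.AlgebraicGeometry.HodgeTheory

/-! ### §1 Compact locally contractible subsets of `X(ℂ)`, `X` smooth projective, are taut -/

/-- **Tautness data in `X(ℂ)` for `X` smooth projective**: every compact `K ⊆ X(ℂ)` with `↥K`
locally contractible carries a `Cech.RetractionNhds` datum — `X(ℂ)` is a compact topological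
manifold (GAGA charts, `IsSmoothProjective.chartedSpace`), embeds in some `ℝᴺ`
(`exists_isClosedEmbedding_pi_of_compactSpace`) with image a neighbourhood retract (Hatcher
Thm. A.7, `isNeighbourhoodRetract_of_locallyContractibleSpace_holds`), and compact locally
contractible subsets of Euclidean neighbourhood retracts are taut
(`Cech.RetractionNhds.nonempty_of_locallyContractibleSpace`, Spanier Thm. 6.1.10 / Cor. 6.1.11).
[cite: Spanier1981, Ch. 6 §1, Thm. 10 and Cor. 11] -/
theorem nonempty_retractionNhds_of_isSmoothProjective {X : Motives.SchemeOver ℂ} {m : ℕ}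
    (hX : Motives.IsSmoothProjective m X) {K : Set (Motives.ComplexPoints X)} (hKc : IsCompact K)
    (hKl : LocallyContractibleSpace K) : Nonempty (Cech.RetractionNhds K) := by
  classical
  letI := hX.chartedSpace
  haveI := Motives.ComplexPoints.compactSpace_of_isSmoothProjective hX
  haveI := Motives.ComplexPoints.t2Space_of_isSmoothProjective hX
  obtain ⟨N, f, hf⟩ := Literature.Geometry.Manifold.exists_isClosedEmbedding_pi_of_compactSpace
    (M := Motives.ComplexPoints X) (EuclideanSpace ℝ (Fin (2 * m)))
  have hNR : IsNeighbourhoodRetract (Set.range f) :=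
    isNeighbourhoodRetract_range_of_compactSpace
      isNeighbourhoodRetract_of_locallyContractibleSpace_holds (EuclideanSpace ℝ (Fin (2 * m)))
      hf.isEmbedding
  exact Cech.RetractionNhds.nonempty_of_locallyContractibleSpace hf.isEmbedding hNR hKc hKl

namespace DworkSextic

attribute [local instance] MvPolynomial.gradedAlgebra

/-! ### §2 The fixed locus of `s_(i,j,ζ)` on `X_ψ(ℂ)` is the hyperplane section `{x_i = ζ x_j}` -/

section Fix

variable (ψ : ℂ) {i j : Fin 6} (hij : i ≠ j) {ζ : ℂ} (hζ : ζ ^ 6 = 1)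

include hζ in
/-- `ζ ≠ 0`. [cite: BiniGarbagnati2012, §3.4] -/
private theorem zeta_ne_zero' : ζ ≠ 0 := by
  rintro rfl
  norm_num at hζ

/-- The form `F_ψ` vanishes on the homogeneous coordinates of every complex point of `X_ψ`
(`pt ψ` takes values in `{F_ψ = 0}`, `range_hypersurfacePoint`). [cite: Katz2009, §2] -/
theorem eval_rep_pt_form (P : Motives.ComplexPoints (fibre ψ)) :
    MvPolynomial.eval (pt ψ P).rep (form ψ) = 0 := by
  have hrange : Set.range (pt ψ) = Projectivization.projZeroLocus {form ψ} :=
    range_hypersurfacePoint (isHomogeneous_form ψ)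
      (Motives.SmoothHypersurface.range_hypersurfaceι (form ψ))
  have hx : pt ψ P ∈ Projectivization.projZeroLocus {form ψ} := hrange ▸ Set.mem_range_self P
  exact hx _ (Set.mem_singleton _)

/-- `F_ψ(v) = Σ v_l⁶ - 6ψ ∏ v_l`. [cite: Katz2009, §2] -/
theorem eval_form (v : Fin 6 → ℂ) :
    MvPolynomial.eval v (form ψ) = (∑ l, v l ^ 6) - 6 * ψ * ∏ l, v l := by
  simp [form, map_sub, map_sum, map_mul, map_prod, eval_X, eval_C]

include hij hζ in
/-- **The fixed points of `s_(i,j,ζ)` on `X_ψ(ℂ)` are the points with `x_i = ζ x_j`.** If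
`[s v] = [v]`, i.e. `v = t • s v`, then either `t = 1` and `v_i = ζ v_j`, or all coordinates
`k ∉ {i, j}` vanish, `t = -1` and `v_i = -ζ v_j` — but then `F_ψ(v) = v_i⁶ + v_j⁶ = 2 v_j⁶ ≠ 0`,
so this isolated fixed point of the reflection of `ℙ⁵` is not on `X_ψ` (Bini–Garbagnati §3.4: "the
fixed locus of `τ` is the divisor `X ∩ {x_1 = x_2}`"). Conversely `v_i = ζ v_j` gives `s v = v`.
[cite: BiniGarbagnati2012, §3.4] -/
theorem pointsAction_eq_self_iff {g : Multiplicative (ZMod 2)} (hg : g ≠ 1)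
    (P : Motives.ComplexPoints (fibre ψ)) :
    Motives.pointsAction (reflAction ψ hij hζ) g P = P ↔ (pt ψ P).rep i = ζ * (pt ψ P).rep j := by
  have hζ0 : ζ ≠ 0 := zeta_ne_zero' hζ
  have hinj := (isEmbedding_hypersurfacePoint
    (Motives.SmoothHypersurface.hypersurfaceι (form ψ))).injective
  obtain ⟨t, ht⟩ := exists_rep_pt_pointsAction_reflAction ψ hij hζ hg P
  set v := (pt ψ P).rep with hv
  have hv0 : v ≠ 0 := (pt ψ P).rep_nonzero
  constructor
  · intro hfix
    rw [hfix] at ht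
    -- `v = t • s v`
    have hti : v i = t * (ζ * v j) := by
      have := congr_fun ht i
      simpa [if_pos rfl] using this
    have htj : v j = t * (ζ⁻¹ * v i) := by
      have := congr_fun ht j
      simpa [if_neg (Ne.symm hij), if_pos rfl] using this
    have htk : ∀ k, k ≠ i → k ≠ j → v k = t * v k := by
      intro k hki hkj
      have := congr_fun ht k
      simpa [if_neg hki, if_neg hkj] using this
    by_cases ht1 : t = 1
    · rw [ht1, one_mul] at hti
      exact hti
    · exfalso
      -- all other coordinates vanish
      have hk0 : ∀ k, k ≠ i → k ≠ j → v k = 0 := by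
        intro k hki hkj
        have h := htk k hki hkj
        have : (1 - t) * v k = 0 := by rw [sub_mul, one_mul, sub_eq_zero]; exact h
        rcases mul_eq_zero.1 this with h1 | h1
        · exact absurd (sub_eq_zero.1 h1).symm ht1
        · exact h1
      -- `t² = 1`, so `t = -1`
      have hvi2 : v i = t ^ 2 * v i := by
        calc v i = t * (ζ * v j) := hti
          _ = t * (ζ * (t * (ζ⁻¹ * v i))) := by rw [← htj]
          _ = t ^ 2 * v i := by field_simp
      have hvj2 : v j = t ^ 2 * v j := by
        calc v j = t * (ζ⁻¹ * v i) := htj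
          _ = t * (ζ⁻¹ * (t * (ζ * v j))) := by rw [← hti]
          _ = t ^ 2 * v j := by field_simp
      have hij0 : v i ≠ 0 ∨ v j ≠ 0 := by
        by_contra h
        push Not at h
        apply hv0
        funext k
        by_cases hki : k = i
        · subst hki; exact h.1
        · by_cases hkj : k = j
          · subst hkj; exact h.2
          · exact hk0 k hki hkj
      have ht2 : t ^ 2 = 1 := by
        rcases hij0 with h | h
        · have : (t ^ 2 - 1) * v i = 0 := by rw [sub_mul, one_mul, ← hvi2, sub_self]
          exact sub_eq_zero.1 ((mul_eq_zero.1 this).resolve_right h)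
        · have : (t ^ 2 - 1) * v j = 0 := by rw [sub_mul, one_mul, ← hvj2, sub_self]
          exact sub_eq_zero.1 ((mul_eq_zero.1 this).resolve_right h)
      have htm : t = -1 := by
        have : (t - 1) * (t + 1) = 0 := by ring_nf; rw [ht2]; ring
        rcases mul_eq_zero.1 this with h | h
        · exact absurd (sub_eq_zero.1 h) ht1
        · exact eq_neg_of_add_eq_zero_left h
      -- `v_i = -ζ v_j`, and `F_ψ(v) = 2 v_j⁶`
      have hvi : v i = -(ζ * v j) := by rw [hti, htm, neg_one_mul]
      have hprod : ∏ l, v l = 0 := by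
        -- some index outside `{i, j}` exists among six
        obtain ⟨k, hki, hkj⟩ : ∃ k : Fin 6, k ≠ i ∧ k ≠ j := by
          by_contra h
          push Not at h
          have hsub : (Finset.univ : Finset (Fin 6)) ⊆ {i, j} := by
            intro k _
            rw [Finset.mem_insert, Finset.mem_singleton]
            by_cases hki : k = i
            · exact Or.inl hki
            · exact Or.inr (h k hki)
          have := Finset.card_le_card hsub
          rw [Finset.card_univ, Fintype.card_fin] at this
          have h2 : ({i, j} : Finset (Fin 6)).card ≤ 2 := Finset.card_insert_le _ _
          omega
        exact Finset.prod_eq_zero (Finset.mem_univ k) (hk0 k hki hkj)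
      have hsum : ∑ l, v l ^ 6 = v i ^ 6 + v j ^ 6 := by
        rw [← Finset.sum_subset (Finset.subset_univ ({i, j} : Finset (Fin 6)))
          (fun k _ hk ↦ by
            rw [Finset.mem_insert, Finset.mem_singleton, not_or] at hk
            rw [hk0 k hk.1 hk.2, zero_pow (by norm_num)]),
          Finset.sum_pair hij]
      have hF := eval_rep_pt_form ψ P
      rw [eval_form, ← hv, hprod, mul_zero, sub_zero, hsum, hvi, neg_pow, mul_pow, hζ] at hF
      have hvj0 : v j = 0 := by
        have : (2 : ℂ) * v j ^ 6 = 0 := by linear_combination hF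
        exact pow_eq_zero_iff (n := 6) (by norm_num) |>.1
          ((mul_eq_zero.1 this).resolve_left (by norm_num))
      have hvi0 : v i = 0 := by rw [hvi, hvj0, mul_zero, neg_zero]
      rcases hij0 with h | h
      · exact h hvi0
      · exact h hvj0
  · intro hvij
    -- `s v = v`, so `pt (g P) = pt P`
    have hsv : (fun k => if k = i then ζ * (pt ψ P).rep j else if k = j then ζ⁻¹ * (pt ψ P).rep i
        else (pt ψ P).rep k) = v := by
      funext k
      by_cases hki : k = i
      · subst hki; rw [if_pos rfl, ← hv, hvij]
      · by_cases hkj : k = j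
        · subst hkj; rw [if_neg hki, if_pos rfl, ← hv, hvij, ← mul_assoc, inv_mul_cancel₀ hζ0, one_mul]
        · rw [if_neg hki, if_neg hkj]
    rw [hsv] at ht
    have ht0 : t ≠ 0 := by
      rintro rfl
      exact (pt ψ (Motives.pointsAction (reflAction ψ hij hζ) g P)).rep_nonzero (by rw [ht, zero_smul])
    apply hinj
    change pt ψ _ = pt ψ P
    have key : Projectivization.mk ℂ (pt ψ (Motives.pointsAction (reflAction ψ hij hζ) g P)).rep
        (Projectivization.rep_nonzero _) = Projectivization.mk ℂ v hv0 :=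
      (Projectivization.mk_eq_mk_iff' ℂ _ _ _ _).2 ⟨t, by rw [ht]⟩
    simpa only [Projectivization.mk_rep, hv] using key

/-- The linear form `x_i - ζ x_j`. [cite: BiniGarbagnati2012, §3.4] -/
def fixForm (i j : Fin 6) (ζ : ℂ) : MvPolynomial (Fin 6) ℂ := X i - C ζ * X j

/-- `x_i - ζ x_j` is homogeneous of degree `1`. [cite: BiniGarbagnati2012, §3.4] -/
theorem isHomogeneous_fixForm (i j : Fin 6) (ζ : ℂ) : (fixForm i j ζ).IsHomogeneous 1 :=
  (isHomogeneous_X ℂ i).sub ((isHomogeneous_C _ ζ).mul (isHomogeneous_X ℂ j))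

/-- **The hyperplane section `X_ψ ∩ {x_i = ζ x_j}` as a Zariski-closed subset of `X_ψ`**: the
complement of the preimage of the basic open `D₊(x_i - ζ x_j)` of `ℙ⁵` under `X_ψ ↪ ℙ⁵`.
[cite: BiniGarbagnati2012, §3.4] -/
def fixLocus (ψ : ℂ) (i j : Fin 6) (ζ : ℂ) : Set (fibre ψ).left :=
  ((Motives.SmoothHypersurface.hypersurfaceι (form ψ)).left ⁻¹ᵁ
    (Proj.basicOpen (MvPolynomial.homogeneousSubmodule (Fin 6) ℂ) (fixForm i j ζ)) : Set (fibre ψ).left)ᶜ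

/-- The hyperplane section is Zariski-closed. [cite: BiniGarbagnati2012, §3.4] -/
theorem isClosed_fixLocus : IsClosed (fixLocus ψ i j ζ) :=
  (TopologicalSpace.Opens.isOpen _).isClosed_compl

/-- **A complex point lies over the hyperplane section iff its homogeneous coordinates satisfy
`x_i = ζ x_j`** (`[z] ∈ D₊(F)` iff `F(z) ≠ 0`, `preimage_projPoint_setOf_pt_mem_basicOpen`).
[cite: BiniGarbagnati2012, §3.4] -/
theorem pt_mem_fixLocus_iff (P : Motives.ComplexPoints (fibre ψ)) :
    P.pt ∈ fixLocus ψ i j ζ ↔ (pt ψ P).rep i = ζ * (pt ψ P).rep j := by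
  have key := Set.ext_iff.mp (preimage_projPoint_setOf_pt_mem_basicOpen 5 (fixForm i j ζ) 1
    (isHomogeneous_fixForm i j ζ)) (pt ψ P)
  rw [Set.mem_preimage, Set.mem_setOf_eq, projPoint_hypersurfacePoint, Motives.AlgPoints.pt_map,
    Set.mem_compl_iff] at key
  have hmem : pt ψ P ∈ Projectivization.projZeroLocus {fixForm i j ζ} ↔
      (pt ψ P).rep i = ζ * (pt ψ P).rep j := by
    change (∀ F ∈ ({fixForm i j ζ} : Set (MvPolynomial (Fin 6) ℂ)), MvPolynomial.eval (pt ψ P).rep F = 0) ↔ _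
    simp only [Set.mem_singleton_iff, forall_eq, fixForm, map_sub, map_mul, eval_X, eval_C, sub_eq_zero]
  rw [← hmem, fixLocus, Set.mem_compl_iff]
  change ¬ ((Motives.SmoothHypersurface.hypersurfaceι (form ψ)).left (Motives.AlgPoints.pt P) ∈
    Proj.basicOpen (MvPolynomial.homogeneousSubmodule (Fin 6) ℂ) (fixForm i j ζ)) ↔ _
  rw [not_congr key, not_not]

include hij hζ in
/-- **The fixed set of `s_(i,j,ζ)` on `X_ψ(ℂ)` is the set of complex points of the hyperplane
section `X_ψ ∩ {x_i = ζ x_j}`.** [cite: BiniGarbagnati2012, §3.4] -/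
theorem setOf_pointsAction_eq_self_eq {g : Multiplicative (ZMod 2)} (hg : g ≠ 1) :
    {P : Motives.ComplexPoints (fibre ψ) | Motives.pointsAction (reflAction ψ hij hζ) g P = P} =
      {P : Motives.ComplexPoints (fibre ψ) | P.pt ∈ fixLocus ψ i j ζ} := by
  ext P
  rw [Set.mem_setOf_eq, Set.mem_setOf_eq, pointsAction_eq_self_iff ψ hij hζ hg, pt_mem_fixLocus_iff]

include hij hζ in
/-- **The fixed set of `s_(i,j,ζ)` on `X_ψ(ℂ)` is locally contractible** (complex points of a
Zariski-closed subset of a projective scheme: semialgebraic triangulation,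
`locallyContractibleSpace_complexPoints`). [cite: BiniGarbagnati2012, §3.4] -/
theorem locallyContractibleSpace_fix {g : Multiplicative (ZMod 2)} (hg : g ≠ 1) :
    LocallyContractibleSpace
      {P : Motives.ComplexPoints (fibre ψ) | Motives.pointsAction (reflAction ψ hij hζ) g P = P} := by
  rw [setOf_pointsAction_eq_self_eq ψ hij hζ hg]
  exact locallyContractibleSpace_complexPoints
    (Motives.SmoothHypersurface.isProjectiveOver_hypersurface (form ψ)).projectiveEmbedding
    (isClosed_fixLocus ψ)

end Fix

/-! ### §3 The transfer for `X_ψ → X_ψ/⟨s⟩`, proved -/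

section Transfer

variable {ψ : ℂ} (hψ : ψ ^ 6 ≠ 1) {i j : Fin 6} (hij : i ≠ j) {ζ : ℂ} (hζ : ζ ^ 6 = 1)

include hψ in
/-- **The transfer for the reflection quotient of the Dwork sextic, PROVED** (granted Bini–Garbagnati
Prop. 3.20 only for the smoothness and projectivity of the quotient): for `ψ⁶ ≠ 1`, `i ≠ j`,
`ζ⁶ = 1` and the quotient map `p : X_ψ → X_ψ/⟨s_(i,j,ζ)⟩`, the pull-back
`p^* : Hᵏ((X_ψ/⟨s⟩)(ℂ); ℂ) → Hᵏ(X_ψ(ℂ); ℂ)` is injective and every `⟨s⟩`-invariant class is in its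
range. The action of `⟨s⟩ ≅ ℤ/2` on `X_ψ(ℂ)` is semi-free (every involution is), its fixed locus
is the hyperplane section `{x_i = ζ x_j}` — locally contractible, hence taut in the compact manifold
`X_ψ(ℂ)` — and the image of the fixed locus is taut in the compact manifold `(X_ψ/⟨s⟩)(ℂ)`; so the
tree's `OrbitMap.transfer_of_card_le_two` (Bredon II.19.2, proved for semi-free actions with taut
fixed locus) applies. [cite: Bredon1997, II Thm. 19.2] [cite: BiniGarbagnati2012, Prop. 3.20] -/
theorem reflTransfer (h : BiniGarbagnati2012_reflectionQuotient_smoothProjective_rcc) (k : ℕ) :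
    Function.Injective (complexBetti.map (reflQuotientMap ψ hij hζ) k) ∧
      ∀ c : complexBetti (fibre ψ) k,
        (∀ g : Multiplicative (ZMod 2),
          singularCohomology.map ℂ ℂ (Motives.pointsAction (reflAction ψ hij hζ) g) k c = c) →
        c ∈ Set.range (complexBetti.map (reflQuotientMap ψ hij hζ) k) := by
  letI : MulAction (Multiplicative (ZMod 2)) (Motives.ComplexPoints (fibre ψ)) :=
    Motives.pointsMulAction (reflAction ψ hij hζ)
  haveI : ContinuousConstSMul (Multiplicative (ZMod 2)) (Motives.ComplexPoints (fibre ψ)) :=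
    Motives.continuousConstSMul_pointsMulAction (reflAction ψ hij hζ)
  have hX : Motives.IsSmoothProjective 4 (fibre ψ) := isSmoothProjective_fibre hψ
  have hY : Motives.IsSmoothProjective 4 (reflQuotient ψ hij hζ) := h.isSmoothProjective hψ hij hζ
  haveI := Motives.ComplexPoints.compactSpace_of_isSmoothProjective hX
  haveI := Motives.ComplexPoints.t2Space_of_isSmoothProjective hX
  haveI := Motives.ComplexPoints.t2Space_of_isSmoothProjective hY
  haveI := isProper_fibre_hom ψ
  haveI := isSeparated_fibre_hom ψ
  set q : C(Motives.ComplexPoints (fibre ψ), Motives.ComplexPoints (reflQuotient ψ hij hζ)) :=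
    Motives.AlgPoints.mapContinuous (L := ℂ) (reflQuotientMap ψ hij hζ) with hqdef
  have hsurj : Function.Surjective q :=
    Motives.map_mk_surjective (reflAction ψ hij hζ) (reflCover ψ hij hζ)
  have horb : ∀ z z' : Motives.ComplexPoints (fibre ψ),
      q z = q z' ↔ ∃ g : Multiplicative (ZMod 2), g • z = z' := by
    intro z z'
    refine ⟨fun hzz' ↦ Motives.exists_pointsAction_eq_of_map_mk_eq (reflAction ψ hij hζ)
      (reflCover ψ hij hζ) hzz', ?_⟩
    rintro ⟨g, rfl⟩
    exact (Motives.map_mk_pointsAction (reflAction ψ hij hζ) (reflCover ψ hij hζ) g z).symm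
  -- the non-trivial element `σ` and the dichotomy `g = 1 ∨ g = σ`
  have hG : ∀ g : Multiplicative (ZMod 2), g = 1 ∨ g = Multiplicative.ofAdd 1 :=
    ActionOver.eq_one_or_eq_gen
  -- the fixed locus: closed, locally contractible, taut; its image: taut
  have hFc : IsClosed {z : Motives.ComplexPoints (fibre ψ) | Multiplicative.ofAdd (1 : ZMod 2) • z = z} :=
    isClosed_eq (continuous_const_smul _) continuous_id
  have hFl : LocallyContractibleSpace
      {z : Motives.ComplexPoints (fibre ψ) | Multiplicative.ofAdd (1 : ZMod 2) • z = z} :=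
    locallyContractibleSpace_fix ψ hij hζ ActionOver.gen_ne_one
  obtain ⟨TF⟩ := nonempty_retractionNhds_of_isSmoothProjective hX hFc.isCompact hFl
  have hfix : ∀ z ∈ {z : Motives.ComplexPoints (fibre ψ) | Multiplicative.ofAdd (1 : ZMod 2) • z = z},
      ∀ g : Multiplicative (ZMod 2), g • z = z := by
    intro z hz g
    rcases hG g with rfl | rfl
    · exact one_smul _ z
    · exact hz
  have hBl := OrbitMap.locallyContractibleSpace_image_of_fix q horb hFc hfix hFl
  obtain ⟨TB⟩ := nonempty_retractionNhds_of_isSmoothProjective hY (hFc.isCompact.image q.continuous) hBl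
  obtain ⟨hinj, hsur⟩ := OrbitMap.transfer_of_card_le_two (R := ℂ) q horb hsurj
    (Multiplicative.ofAdd (1 : ZMod 2)) hG TF TB k
  refine ⟨hinj, fun c hc ↦ hsur c fun g ↦ ?_⟩
  have e : (⟨fun z ↦ g • z, continuous_const_smul g⟩ :
      C(Motives.ComplexPoints (fibre ψ), Motives.ComplexPoints (fibre ψ))) =
      Motives.pointsAction (reflAction ψ hij hζ) g := ContinuousMap.ext fun _ ↦ rfl
  rw [e]
  exact hc g

/-! ### §4 Consequences: reflection-invariant classes descend; invariant rational `(2,2)`-classes are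
algebraic — granted Bini–Garbagnati only -/

include hψ in
/-- **Descent of reflection-invariant classes to the quotient** (`ψ⁶ ≠ 1`), granted ONLY
Bini–Garbagnati Prop. 3.20: if `g` is any continuous self-map of `X_ψ(ℂ)` realising `s_(i,j,ζ)` on
homogeneous coordinates and `c ∈ Hᵏ(X_ψ(ℂ); ℂ)` is a rational class of type `(p, q)` with
`g^* c = c`, then `c = p^* d` for a rational class `d` of type `(p, q)` on `X_ψ/⟨s⟩` — the transfer
being the PROVED `reflTransfer` (the tree's `exists_rational_hodge_map_reflQuotientMap_eq` assumed
Bredon's transfer as a named fact). [cite: BiniGarbagnati2012, Prop. 3.20] [cite: Bredon1997, II Thm. 19.2] -/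
theorem exists_rational_hodge_map_reflQuotientMap_eq_of_BG
    (h : BiniGarbagnati2012_reflectionQuotient_smoothProjective_rcc)
    {g : C(Motives.ComplexPoints (fibre ψ), Motives.ComplexPoints (fibre ψ))}
    (hg : ∀ x, ∃ t : ℂ, (pt ψ (g x)).rep = t • (fun k => if k = i then ζ * (pt ψ x).rep j
      else if k = j then ζ⁻¹ * (pt ψ x).rep i else (pt ψ x).rep k))
    {k p q : ℕ} (hpq : p + q = k) {c : complexBetti (fibre ψ) k} (hcr : IsRationalClass c)
    (hct : IsOfHodgeType 4 (fibre ψ) k p q c) (hc : singularCohomology.map ℂ ℂ g k c = c) :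
    ∃ d : complexBetti (reflQuotient ψ hij hζ) k, IsRationalClass d ∧
      IsOfHodgeType 4 (reflQuotient ψ hij hζ) k p q d ∧
        complexBetti.map (reflQuotientMap ψ hij hζ) k d = c := by
  haveI := isProper_fibre_hom ψ
  haveI := isSeparated_fibre_hom ψ
  have hinv : ∀ g₀ : Multiplicative (ZMod 2),
      singularCohomology.map ℂ ℂ (Motives.pointsAction (reflAction ψ hij hζ) g₀) k c = c := by
    refine (forall_map_pointsAction_eq_iff ψ hij hζ c ActionOver.gen_ne_one).2 ?_
    rw [← eq_pointsAction_of_isRefl ψ hij hζ hg ActionOver.gen_ne_one]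
    exact hc
  exact Motives.exists_rational_hodge_map_mk_eq_of_transfer (reflAction ψ hij hζ) (reflCover ψ hij hζ)
    (isSmoothProjective_fibre hψ) (h.isSmoothProjective hψ hij hζ) hpq (reflTransfer hψ hij hζ h k)
    hcr hct hinv

include hψ hij hζ in
/-- **Reflection-invariant rational `(2,2)`-classes on the Dwork sextic are algebraic** (`ψ⁶ ≠ 1`),
granted Bini–Garbagnati Prop. 3.20 and Fulton's pull-back shape ONLY — Bredon's transfer, the third
hypothesis of the tree's `mem_algebraicClasses_of_isRefl_invariant`, is now the theorem
`reflTransfer`. Proof: `c = p^* d` with `d` rational of type `(2,2)` on `Z = X_ψ/⟨s⟩`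
(`exists_rational_hodge_map_reflQuotientMap_eq_of_BG`); `d` is algebraic by the Hodge conjecture
for the smooth projective rationally chain connected fourfold `Z` (`hodgeConjectureFor_reflQuotient`,
Bloch–Srinivas); `p^* d` is algebraic (Fulton). [cite: BiniGarbagnati2012, Prop. 3.20]
[cite: Fulton1998, §19.2 Cor. 19.2 (b)] [cite: BlochSrinivas1983, Thm. 1 (3)] -/
theorem mem_algebraicClasses_of_isRefl_invariant_of_BG
    (h : BiniGarbagnati2012_reflectionQuotient_smoothProjective_rcc)
    (hF : fulton1998_map_mem_algebraicClasses)
    {g : C(Motives.ComplexPoints (fibre ψ), Motives.ComplexPoints (fibre ψ))}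
    (hg : ∀ x, ∃ t : ℂ, (pt ψ (g x)).rep = t • (fun k => if k = i then ζ * (pt ψ x).rep j
      else if k = j then ζ⁻¹ * (pt ψ x).rep i else (pt ψ x).rep k))
    {c : complexBetti (fibre ψ) (2 * 2)} (hcr : IsRationalClass c)
    (hct : IsOfHodgeType 4 (fibre ψ) (2 * 2) 2 2 c) (hc : singularCohomology.map ℂ ℂ g (2 * 2) c = c) :
    c ∈ algebraicClasses (fibre ψ) 2 := by
  obtain ⟨d, hdr, hdt, rfl⟩ :=
    exists_rational_hodge_map_reflQuotientMap_eq_of_BG hψ hij hζ h hg rfl hcr hct hc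
  have hd : d ∈ algebraicClasses (reflQuotient ψ hij hζ) 2 :=
    (hodgeConjectureFor_reflQuotient hψ hij hζ h).2 2 d hdr hdt
  exact hF (reflQuotientMap ψ hij hζ) (h.isSmoothProjective hψ hij hζ) (isSmoothProjective_fibre hψ) 2 d hd

end Transfer

end DworkSextic

end Literature.AlgebraicGeometry.HodgeTheory

end
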